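import Mathlib
import Summits.NavierStokesRegularity.NavierStokesRegularity.Theses.SubOnsagerCeiling
import Summits.NavierStokesRegularity.NavierStokesRegularity.Theorems.SubOnsagerCeilingSmallRatioSuffices
import Summits.NavierStokesRegularity.NavierStokesRegularity.Theorems.SubOnsagerCeilingKPUnitViscosity
import Summits.NavierStokesRegularity.NavierStokesRegularity.Theorems.SubOnsagerCeilingKPSmallDatumBarrier
import Summits.NavierStokesRegularity.NavierStokesRegularity.Theorems.SubOnsagerCeilingKPLargeDataRemainder
import HarnessLib

/-!
# The rung target from the LARGE-DATA, UNIT-VISCOSITY, SMALL-RATIO KP ceiling (per-table reductions + by-name composition)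
# (helper file for the crux `SubOnsagerCeiling.ForwardTailCeilingKP`, stmt-NavierStokesRegularity-27057, `--supports`;
# hand leafhand-ns-subonsagerceiling-4 gen 25 — a by-name REDUCTION for the planner; def-free)

Per-table forms of this hand's two normal forms (p843933 unit viscosity, p843964/p843980 small-datum corner and large-data
remainder), and their composition with gen 22's `taoLadderTarget_of_kpSmallRatioCeiling`:

* `fwdCeilingKPBody_of_unitViscosity` — for ONE table at ONE ratio, the crux body (`∃ S θ C` before `∀ ν > 0`) follows from
  the same body at `ν = 1` with the datum free;
* `fwdCeilingKPBody_of_largeDataUnitViscosity` — … and (for `ε₀ > 0`) from the same body at `ν = 1` restricted to one-shell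
  data ABOVE the dissipation threshold `1 ≤ 512(1+ε₀)^{16}√(2E₀)` (small data: `SmallDatum.smallDatum_shellBarrier_of_inTableClass`
  + `LargeData.tail_le_of_shellBarrier`);
* **`taoLadderTarget_of_kpLargeDataSmallRatioCeiling`** — the leaf `Theses.TaoLadderRungTwoBreak.Target` from the two declared
  residuals `NonDiagonalOrthantBreak` (stmt-27000), `NonOrthantBreak` (stmt-24640), the closed `OrthantInvariance`, and the
  WEAKEST by-name form of the KP crux reached so far:
  «`∀ R ≥ 1, ∃ εR > 0, ∀ ε₀ ∈ (0, εR], ∀ α` KP-proper in `E₂(R)`, `∃ S ⊇ S⁺(α), θ > 1/2, C ≥ 0`, for every one-shell datum with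
  `512(1+ε₀)^{16}√(2E₀) ≥ 1` and every honest UNIT-VISCOSITY solution on `[0,s]`: `Σ_{k=n..N}Σ_{i∈S}½X_{i,k}(t)² ≤ C E₀(1+ε₀)^{-2θn}`».

READING (for the planner): small ratio (gen 22) × unit viscosity × large data (this hand) is what the leaf consumes of item 27057;
every other quantifier of the typed crux is bookkeeping.  HONEST FRAMING: reductions between statements about Tao-type MODEL
lattice ODEs (route SubOnsagerCeiling, rung TL-M2Break); the large-data small-ratio ceiling is OPEN; no stub, crux, rung target
or summit is proved here and nothing bears on Navier–Stokes regularity.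
[cite: Tao2016AveragedNS, §4 Lemma 4.1 (4.5), (4.8), (4.13), Thm. 4.2] [cite: BarbatoMorandinRomito2011, §3.1 Prop. 3.3, §3.2]
-/

noncomputable section

-- the summit and its single sub-problem share the name (CONVENTIONS §1)
set_option linter.dupNamespace false

open Set

namespace Summit.NavierStokesRegularity.NavierStokesRegularity.Theorems.SubOnsagerCeiling.LargeData

open Literature.Analysis.FluidPDE Literature.Analysis.FluidPDE.TaoCascade
open Summit.NavierStokesRegularity.NavierStokesRegularity.Theses.SubOnsagerCeiling
open Summit.NavierStokesRegularity.NavierStokesRegularity.Theorems.SubOnsagerCeiling.UnitViscosity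
open Summit.NavierStokesRegularity.NavierStokesRegularity.Theorems.SubOnsagerCeiling.SmallDatum

/-- **Per table: unit viscosity suffices for the crux body.** [cite: Tao2016AveragedNS, §4 (4.8), (4.13)] -/
theorem fwdCeilingKPBody_of_unitViscosity {R ε₀ : ℝ} {α : Fin 4 → Fin 4 → Fin 4 → ℤ × ℤ × ℤ → ℝ}
    (h : InTableClass R α →
      (∀ (Y : Fin 4 → ℤ → ℝ → ℝ) (τ : ℝ), (∀ (j : Fin 4) (k : ℤ), 1 ≤ k → 0 ≤ Y j k τ) → ∀ δ : ℝ, 0 < δ →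
        ∀ (i : Fin 4) (n : ℤ), 1 ≤ n → Y i n τ = 0 → 0 ≤ quadTerm δ α Y i n τ) →
      (∀ a b i : Fin 4, a ≠ b → α a b i (0, 0, 1) = 0) →
      ∃ S : Finset (Fin 4), (∀ i, i ∉ S → ∀ j l : Fin 4, α i j l (0, 0, 1) = 0) ∧
      ∃ θ : ℝ, 1 / 2 < θ ∧ ∃ C : ℝ, 0 ≤ C ∧ ∀ (X₀ : Fin 4 → ℝ) (s : ℝ), 0 < s → ∀ X : Fin 4 → ℤ → ℝ → ℝ,
        (∀ (i : Fin 4) (k : ℤ), X i k 0 = if k = 0 then X₀ i else 0) →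
        (∀ (i : Fin 4) (k : ℤ), k < 0 → ∀ t : ℝ, X i k t = 0) →
        (∃ M : ℝ, ∀ (t : ℝ) (i : Fin 4) (k : ℤ), (1 + (1 + ε₀) ^ ((10 : ℝ) * k)) * |X i k t| ≤ M) →
        (∀ (i : Fin 4) (k : ℤ), Continuous (X i k)) →
        (∀ (i : Fin 4) (k : ℤ), ∀ t ∈ Icc (0 : ℝ) s, HasDerivWithinAt (X i k)
          (quadTerm ε₀ α X i k t - (1 + ε₀) ^ ((2 : ℝ) * k) * X i k t) (Icc (0 : ℝ) s) t) →
        (∀ t ∈ Icc (0 : ℝ) s, ∀ (i : Fin 4) (k : ℤ), 1 ≤ k → 0 ≤ X i k t) →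
        ∀ n N : ℕ, n ≤ N → ∀ t ∈ Icc (0 : ℝ) s,
          ∑ k ∈ Finset.Icc n N, ∑ i ∈ S, (1 / 2 : ℝ) * X i (k : ℤ) t ^ 2 ≤
            C * (∑ i : Fin 4, (1 / 2 : ℝ) * X₀ i ^ 2) * (1 + ε₀) ^ (-(2 * θ * (n : ℝ)))) :
    InTableClass R α →
      (∀ (Y : Fin 4 → ℤ → ℝ → ℝ) (τ : ℝ), (∀ (j : Fin 4) (k : ℤ), 1 ≤ k → 0 ≤ Y j k τ) → ∀ δ : ℝ, 0 < δ →
        ∀ (i : Fin 4) (n : ℤ), 1 ≤ n → Y i n τ = 0 → 0 ≤ quadTerm δ α Y i n τ) →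
      (∀ a b i : Fin 4, a ≠ b → α a b i (0, 0, 1) = 0) →
      ∃ S : Finset (Fin 4), (∀ i, i ∉ S → ∀ j l : Fin 4, α i j l (0, 0, 1) = 0) ∧
      ∃ θ : ℝ, 1 / 2 < θ ∧ ∃ C : ℝ, 0 ≤ C ∧ ∀ ν : ℝ, 0 < ν → ∀ (X₀ : Fin 4 → ℝ) (s : ℝ), 0 < s →
        ∀ X : Fin 4 → ℤ → ℝ → ℝ,
        (∀ (i : Fin 4) (k : ℤ), X i k 0 = if k = 0 then X₀ i else 0) →
        (∀ (i : Fin 4) (k : ℤ), k < 0 → ∀ t : ℝ, X i k t = 0) →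
        (∃ M : ℝ, ∀ (t : ℝ) (i : Fin 4) (k : ℤ), (1 + (1 + ε₀) ^ ((10 : ℝ) * k)) * |X i k t| ≤ M) →
        (∀ (i : Fin 4) (k : ℤ), Continuous (X i k)) →
        (∀ (i : Fin 4) (k : ℤ), ∀ t ∈ Icc (0 : ℝ) s, HasDerivWithinAt (X i k)
          (quadTerm ε₀ α X i k t - ν * (1 + ε₀) ^ ((2 : ℝ) * k) * X i k t) (Icc (0 : ℝ) s) t) →
        (∀ t ∈ Icc (0 : ℝ) s, ∀ (i : Fin 4) (k : ℤ), 1 ≤ k → 0 ≤ X i k t) →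
        ∀ n N : ℕ, n ≤ N → ∀ t ∈ Icc (0 : ℝ) s,
          ∑ k ∈ Finset.Icc n N, ∑ i ∈ S, (1 / 2 : ℝ) * X i (k : ℤ) t ^ 2 ≤
            C * (∑ i : Fin 4, (1 / 2 : ℝ) * X₀ i ^ 2) * (1 + ε₀) ^ (-(2 * θ * (n : ℝ))) := by
  intro hT hO hD
  obtain ⟨S, hS, θ, hθ, C, hC, H⟩ := h hT hO hD
  refine ⟨S, hS, θ, hθ, C, hC, fun ν hν X₀ s hs X hX0 hXneg hM hXc hXd hXpos n N hnN t ht => ?_⟩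
  set c : ℝ := ν⁻¹ with hc_def
  have hc : 0 < c := inv_pos.mpr hν
  have hcν : c * ν = 1 := inv_mul_cancel₀ hν.ne'
  have hYd := ampTimeScale_hasDerivWithinAt (ε₀ := ε₀) (ν := ν) (s := s) hc (α := α) (X := X) hXd
  simp only [hcν, one_mul] at hYd
  have key := H (fun i => c * X₀ i) (s / c) (div_pos hs hc) (fun i k t => c * X i k (c * t))
    (ampTimeScale_datum hX0) (ampTimeScale_vanish hXneg) (ampTimeScale_weighted hc hM)
    (ampTimeScale_continuous hXc) hYd (ampTimeScale_nonneg hc hXpos) n N hnN (t / c) (div_mem_Icc_of_mem_Icc hc ht)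
  have hct : c * (t / c) = t := mul_div_cancel₀ t hc.ne'
  simp only [hct] at key
  rw [energy_smul] at key
  have hc2 : 0 < c ^ 2 := by positivity
  have e1 : ∑ k ∈ Finset.Icc n N, ∑ i ∈ S, (1 / 2 : ℝ) * (c * X i (k : ℤ) t) ^ 2 =
      c ^ 2 * ∑ k ∈ Finset.Icc n N, ∑ i ∈ S, (1 / 2 : ℝ) * X i (k : ℤ) t ^ 2 := by
    rw [Finset.mul_sum]
    refine Finset.sum_congr rfl fun k _ => ?_
    rw [Finset.mul_sum]
    exact Finset.sum_congr rfl fun i _ => by ring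
  have e2 : C * (c ^ 2 * ∑ i : Fin 4, (1 / 2 : ℝ) * X₀ i ^ 2) * (1 + ε₀) ^ (-(2 * θ * (n : ℝ))) =
      c ^ 2 * (C * (∑ i : Fin 4, (1 / 2 : ℝ) * X₀ i ^ 2) * (1 + ε₀) ^ (-(2 * θ * (n : ℝ)))) := by ring
  rw [e1, e2] at key
  exact le_of_mul_le_mul_left key hc2

/-- **Per table: the large-data unit-viscosity body suffices for the crux body** (`ε₀ > 0`).
[cite: Tao2016AveragedNS, §4 Lemma 4.1 (4.5), (4.8), (4.13)] [cite: BarbatoMorandinRomito2011, §3.1 Prop. 3.3, §3.2] -/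
theorem fwdCeilingKPBody_of_largeDataUnitViscosity {R ε₀ : ℝ} (hε : 0 < ε₀)
    {α : Fin 4 → Fin 4 → Fin 4 → ℤ × ℤ × ℤ → ℝ}
    (h : InTableClass R α →
      (∀ (Y : Fin 4 → ℤ → ℝ → ℝ) (τ : ℝ), (∀ (j : Fin 4) (k : ℤ), 1 ≤ k → 0 ≤ Y j k τ) → ∀ δ : ℝ, 0 < δ →
        ∀ (i : Fin 4) (n : ℤ), 1 ≤ n → Y i n τ = 0 → 0 ≤ quadTerm δ α Y i n τ) →
      (∀ a b i : Fin 4, a ≠ b → α a b i (0, 0, 1) = 0) →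
      ∃ S : Finset (Fin 4), (∀ i, i ∉ S → ∀ j l : Fin 4, α i j l (0, 0, 1) = 0) ∧
      ∃ θ : ℝ, 1 / 2 < θ ∧ ∃ C : ℝ, 0 ≤ C ∧ ∀ (X₀ : Fin 4 → ℝ) (s : ℝ), 0 < s →
        1 ≤ 512 * (1 + ε₀) ^ (16 : ℝ) * Real.sqrt (2 * ∑ j : Fin 4, (1 / 2 : ℝ) * X₀ j ^ 2) →
        ∀ X : Fin 4 → ℤ → ℝ → ℝ,
        (∀ (i : Fin 4) (k : ℤ), X i k 0 = if k = 0 then X₀ i else 0) →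
        (∀ (i : Fin 4) (k : ℤ), k < 0 → ∀ t : ℝ, X i k t = 0) →
        (∃ M : ℝ, ∀ (t : ℝ) (i : Fin 4) (k : ℤ), (1 + (1 + ε₀) ^ ((10 : ℝ) * k)) * |X i k t| ≤ M) →
        (∀ (i : Fin 4) (k : ℤ), Continuous (X i k)) →
        (∀ (i : Fin 4) (k : ℤ), ∀ t ∈ Icc (0 : ℝ) s, HasDerivWithinAt (X i k)
          (quadTerm ε₀ α X i k t - (1 + ε₀) ^ ((2 : ℝ) * k) * X i k t) (Icc (0 : ℝ) s) t) →
        (∀ t ∈ Icc (0 : ℝ) s, ∀ (i : Fin 4) (k : ℤ), 1 ≤ k → 0 ≤ X i k t) →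
        ∀ n N : ℕ, n ≤ N → ∀ t ∈ Icc (0 : ℝ) s,
          ∑ k ∈ Finset.Icc n N, ∑ i ∈ S, (1 / 2 : ℝ) * X i (k : ℤ) t ^ 2 ≤
            C * (∑ i : Fin 4, (1 / 2 : ℝ) * X₀ i ^ 2) * (1 + ε₀) ^ (-(2 * θ * (n : ℝ)))) :
    InTableClass R α →
      (∀ (Y : Fin 4 → ℤ → ℝ → ℝ) (τ : ℝ), (∀ (j : Fin 4) (k : ℤ), 1 ≤ k → 0 ≤ Y j k τ) → ∀ δ : ℝ, 0 < δ →
        ∀ (i : Fin 4) (n : ℤ), 1 ≤ n → Y i n τ = 0 → 0 ≤ quadTerm δ α Y i n τ) →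
      (∀ a b i : Fin 4, a ≠ b → α a b i (0, 0, 1) = 0) →
      ∃ S : Finset (Fin 4), (∀ i, i ∉ S → ∀ j l : Fin 4, α i j l (0, 0, 1) = 0) ∧
      ∃ θ : ℝ, 1 / 2 < θ ∧ ∃ C : ℝ, 0 ≤ C ∧ ∀ ν : ℝ, 0 < ν → ∀ (X₀ : Fin 4 → ℝ) (s : ℝ), 0 < s →
        ∀ X : Fin 4 → ℤ → ℝ → ℝ,
        (∀ (i : Fin 4) (k : ℤ), X i k 0 = if k = 0 then X₀ i else 0) →
        (∀ (i : Fin 4) (k : ℤ), k < 0 → ∀ t : ℝ, X i k t = 0) →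
        (∃ M : ℝ, ∀ (t : ℝ) (i : Fin 4) (k : ℤ), (1 + (1 + ε₀) ^ ((10 : ℝ) * k)) * |X i k t| ≤ M) →
        (∀ (i : Fin 4) (k : ℤ), Continuous (X i k)) →
        (∀ (i : Fin 4) (k : ℤ), ∀ t ∈ Icc (0 : ℝ) s, HasDerivWithinAt (X i k)
          (quadTerm ε₀ α X i k t - ν * (1 + ε₀) ^ ((2 : ℝ) * k) * X i k t) (Icc (0 : ℝ) s) t) →
        (∀ t ∈ Icc (0 : ℝ) s, ∀ (i : Fin 4) (k : ℤ), 1 ≤ k → 0 ≤ X i k t) →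
        ∀ n N : ℕ, n ≤ N → ∀ t ∈ Icc (0 : ℝ) s,
          ∑ k ∈ Finset.Icc n N, ∑ i ∈ S, (1 / 2 : ℝ) * X i (k : ℤ) t ^ 2 ≤
            C * (∑ i : Fin 4, (1 / 2 : ℝ) * X₀ i ^ 2) * (1 + ε₀) ^ (-(2 * θ * (n : ℝ))) := by
  refine fwdCeilingKPBody_of_unitViscosity fun hT hO hD => ?_
  obtain ⟨S, hS, θ, hθ, C, hC, H⟩ := h hT hO hD
  have hb : (1 : ℝ) < 1 + ε₀ := by linarith
  have hb1 : (1 : ℝ) ≤ 1 + ε₀ := hb.le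
  set θ' : ℝ := min θ 9 with hθ'
  have hθ'pos : 1 / 2 < θ' := lt_min hθ (by norm_num)
  have hθ'le : θ' ≤ θ := min_le_left _ _
  have hθ'9 : θ' ≤ 9 := min_le_right _ _
  set r : ℝ := (1 + ε₀) ^ (-(2 * θ')) with hr_def
  have hr1 : r < 1 := by
    have : (1 + ε₀) ^ (-(2 * θ')) < (1 + ε₀) ^ (0 : ℝ) :=
      Real.rpow_lt_rpow_of_exponent_lt hb (by linarith)
    simpa [hr_def] using this
  have h1r : 0 < 1 - r := by linarith
  set C' : ℝ := max C (4 * 4 / (1 - r)) with hC'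
  have hCC' : C ≤ C' := le_max_left _ _
  have hC'0 : 0 ≤ C' := hC.trans hCC'
  refine ⟨S, hS, θ', hθ'pos, C', hC'0, fun X₀ s hs X hX0 hXneg hM hXc hXd hXpos n N hnN t ht => ?_⟩
  set E₀ : ℝ := ∑ j : Fin 4, (1 / 2 : ℝ) * X₀ j ^ 2 with hE₀
  have hE₀0 : 0 ≤ E₀ := Finset.sum_nonneg fun j _ => by positivity
  have hwn : 0 ≤ (1 + ε₀) ^ (-(2 * θ' * (n : ℝ))) := Real.rpow_nonneg (by linarith) _
  by_cases hbig : 1 ≤ 512 * (1 + ε₀) ^ (16 : ℝ) * Real.sqrt (2 * E₀)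
  · have key := H X₀ s hs hbig X hX0 hXneg hM hXc hXd hXpos n N hnN t ht
    have hmono : (1 + ε₀) ^ (-(2 * θ * (n : ℝ))) ≤ (1 + ε₀) ^ (-(2 * θ' * (n : ℝ))) :=
      Real.rpow_le_rpow_of_exponent_le hb1 (by
        have : (0 : ℝ) ≤ (n : ℝ) := Nat.cast_nonneg n
        nlinarith)
    calc ∑ k ∈ Finset.Icc n N, ∑ i ∈ S, (1 / 2 : ℝ) * X i (k : ℤ) t ^ 2
        ≤ C * E₀ * (1 + ε₀) ^ (-(2 * θ * (n : ℝ))) := key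
      _ ≤ C * E₀ * (1 + ε₀) ^ (-(2 * θ' * (n : ℝ))) := mul_le_mul_of_nonneg_left hmono (by positivity)
      _ ≤ C' * E₀ * (1 + ε₀) ^ (-(2 * θ' * (n : ℝ))) :=
          mul_le_mul_of_nonneg_right (mul_le_mul_of_nonneg_right hCC' hE₀0) hwn
  · have hsmall : 512 * (1 + ε₀) ^ (16 : ℝ) * Real.sqrt (2 * E₀) < 1 := lt_of_not_ge hbig
    have hXd1 : ∀ (i : Fin 4) (k : ℤ), ∀ t ∈ Icc (0 : ℝ) s, HasDerivWithinAt (X i k)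
        (quadTerm ε₀ α X i k t - 1 * (1 + ε₀) ^ ((2 : ℝ) * k) * X i k t) (Icc (0 : ℝ) s) t :=
      fun i k t ht => by rw [one_mul]; exact hXd i k t ht
    have hbar := smallDatum_shellBarrier_of_inTableClass (θ := θ') hε one_pos hθ'9 hT hsmall hs.le
      hX0 hXneg hM hXc hXd1 t ht
    have htail := tail_le_of_shellBarrier (D := 4) (E₀ := E₀) hε (by linarith) (by norm_num) hE₀0 S
      (X := X) (fun i _ k => hbar i k) hnN
    calc ∑ k ∈ Finset.Icc n N, ∑ i ∈ S, (1 / 2 : ℝ) * X i (k : ℤ) t ^ 2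
        ≤ 4 * 4 / (1 - r) * E₀ * (1 + ε₀) ^ (-(2 * θ' * (n : ℝ))) := htail
      _ ≤ C' * E₀ * (1 + ε₀) ^ (-(2 * θ' * (n : ℝ))) :=
          mul_le_mul_of_nonneg_right (mul_le_mul_of_nonneg_right (le_max_right _ _) hE₀0) hwn

/-- **THE RUNG TARGET FROM THE LARGE-DATA, UNIT-VISCOSITY, SMALL-RATIO KP CEILING.**  The leaf
`Theses.TaoLadderRungTwoBreak.Target` follows from the closed item `OrthantInvariance`, the two declared residuals
`NonDiagonalOrthantBreak` (stmt-27000) and `NonOrthantBreak` (stmt-24640), and the following weakening of the crux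
`ForwardTailCeilingKP`: for every spread `R ≥ 1` there is `εR > 0` such that for every scale ratio `1+ε₀`, `ε₀ ∈ (0, εR]`,
and every KP network proper `α ∈ E₂(R)` (orthant, diagonal feeds) there are `S ⊇ S⁺(α)`, `θ > 1/2`, `C ≥ 0` with the
forward-source tail ceiling `Σ_{k=n..N} Σ_{i∈S} ½X_{i,k}(t)² ≤ C·E₀·(1+ε₀)^{-2θn}` along every honest UNIT-VISCOSITY solution on
`[0,s]` from every one-shell datum ABOVE the dissipation threshold, `512(1+ε₀)^{16}√(2E₀) ≥ 1`.
(gen 22's `taoLadderTarget_of_kpSmallRatioCeiling` ∘ `fwdCeilingKPBody_of_largeDataUnitViscosity`.)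
[cite: Tao2016AveragedNS, §4 Lemma 4.1, Thm. 4.2, (4.13)] [cite: BarbatoMorandinRomito2011, §3.1 Prop. 3.3, §3.2] -/
theorem taoLadderTarget_of_kpLargeDataSmallRatioCeiling
    (hL : ∀ R : ℝ, 1 ≤ R → ∃ εR : ℝ, 0 < εR ∧ ∀ ε₀ : ℝ, 0 < ε₀ → ε₀ ≤ εR →
      ∀ α : Fin 4 → Fin 4 → Fin 4 → ℤ × ℤ × ℤ → ℝ,
      InTableClass R α →
      (∀ (Y : Fin 4 → ℤ → ℝ → ℝ) (τ : ℝ), (∀ (j : Fin 4) (k : ℤ), 1 ≤ k → 0 ≤ Y j k τ) → ∀ δ : ℝ, 0 < δ →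
        ∀ (i : Fin 4) (n : ℤ), 1 ≤ n → Y i n τ = 0 → 0 ≤ quadTerm δ α Y i n τ) →
      (∀ a b i : Fin 4, a ≠ b → α a b i (0, 0, 1) = 0) →
      ∃ S : Finset (Fin 4), (∀ i, i ∉ S → ∀ j l : Fin 4, α i j l (0, 0, 1) = 0) ∧
      ∃ θ : ℝ, 1 / 2 < θ ∧ ∃ C : ℝ, 0 ≤ C ∧ ∀ (X₀ : Fin 4 → ℝ) (s : ℝ), 0 < s →
        1 ≤ 512 * (1 + ε₀) ^ (16 : ℝ) * Real.sqrt (2 * ∑ j : Fin 4, (1 / 2 : ℝ) * X₀ j ^ 2) →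
        ∀ X : Fin 4 → ℤ → ℝ → ℝ,
        (∀ (i : Fin 4) (k : ℤ), X i k 0 = if k = 0 then X₀ i else 0) →
        (∀ (i : Fin 4) (k : ℤ), k < 0 → ∀ t : ℝ, X i k t = 0) →
        (∃ M : ℝ, ∀ (t : ℝ) (i : Fin 4) (k : ℤ), (1 + (1 + ε₀) ^ ((10 : ℝ) * k)) * |X i k t| ≤ M) →
        (∀ (i : Fin 4) (k : ℤ), Continuous (X i k)) →
        (∀ (i : Fin 4) (k : ℤ), ∀ t ∈ Icc (0 : ℝ) s, HasDerivWithinAt (X i k)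
          (quadTerm ε₀ α X i k t - (1 + ε₀) ^ ((2 : ℝ) * k) * X i k t) (Icc (0 : ℝ) s) t) →
        (∀ t ∈ Icc (0 : ℝ) s, ∀ (i : Fin 4) (k : ℤ), 1 ≤ k → 0 ≤ X i k t) →
        ∀ n N : ℕ, n ≤ N → ∀ t ∈ Icc (0 : ℝ) s,
          ∑ k ∈ Finset.Icc n N, ∑ i ∈ S, (1 / 2 : ℝ) * X i (k : ℤ) t ^ 2 ≤
            C * (∑ i : Fin 4, (1 / 2 : ℝ) * X₀ i ^ 2) * (1 + ε₀) ^ (-(2 * θ * (n : ℝ))))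
    (h2 : OrthantInvariance) (h5 : NonDiagonalOrthantBreak) (h4 : NonOrthantBreak) :
    Summit.NavierStokesRegularity.NavierStokesRegularity.Theses.TaoLadderRungTwoBreak.Target := by
  refine Summit.NavierStokesRegularity.NavierStokesRegularity.Theorems.taoLadderTarget_of_kpSmallRatioCeiling
    (fun R hR => ?_) h2 h5 h4
  obtain ⟨εR, hεR, HR⟩ := hL R hR
  exact ⟨εR, hεR, fun ε₀ h0 hle α => fwdCeilingKPBody_of_largeDataUnitViscosity h0 (HR ε₀ h0 hle α)⟩

end Summit.NavierStokesRegularity.NavierStokesRegularity.Theorems.SubOnsagerCeiling.LargeData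

end
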